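import Mathlib
import Literature.Probability.Percolation.SharpnessDCTProofs
import Literature.Probability.Percolation.CriticalOneArmBKLowerBound
import Literature.Barriers.CriticalPhenomena.GaussianDominationRoute
import Literature.Barriers.CriticalPhenomena.KozmaNachmiasLemma31
import Summits.CriticalPhenomena.PercolationContinuityZ3.Theorems.PercHyperscalingGluingBoxGluingStubBkSplit
import Summits.CriticalPhenomena.PercolationContinuityZ3.Theses.PercHyperscalingGluing
import Summits.CriticalPhenomena.PercolationContinuityZ3.Theses.PercTwoPointDecay
import HarnessLib

/-!
# `stub_boxRestriction` of line `registered` (crux `BoxGluing`, stmt-CriticalPhenomena-4643):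
# what is provable about BOX RESTRICTION (BR), and why the stub itself is blocked

presearch: BR → none (`lit search --hybrid "restricted two-point function inside a box … full-space
… localization" -n 8` and `lit vsearch "… sum over a box of connection probabilities … inside a larger
box" -k 8`: textbooks only, Slade 2006 / Heydenreich–van der Hofstad 2017 / Grimmett 1999 / Kesten 1982;
`lit galaxy search` queued > 90 s twice); the printed word on the passage box-restricted → full-space is
Hutchcroft 2022 p.5 (arXiv:2202.07634, quoted in tree, `GaussianDominationRoute.lean` barrier
`GaussianDominationRouteNarrow`): "we are not aware of any techniques to pass from estimates of this
form to full-space estimates".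

Registered stub BR (lead reshape r3 of `Cruxes/BoxGluing/Lines/birth.lean`):
`∃ C > 0, K ≥ 1, ∀ n ≥ 1, Σ_{x∈Λ_n} τ(0,x) ≤ C Σ_{x∈Λ_n} τ^{Λ_{Kn}}(0,x)` for bond percolation on `ℤ³`
at `p_c = criticalProbI 3` (`Λ_m = box 3 m`, `τ(0,x) = P(0 ↔ x)`, `τ^S(0,x) = P(0 ↔ x inside S)`).
VERDICT: blocked — not landed as stated.  Proved here (no `sorry`, no new definitions):

* §1 QUALITATIVE BR `exists_scale_sum_openConn_le`: `∀ n, ∃ M, Σ_{Λ_n} τ ≤ 2 Σ_{Λ_n} τ^{Λ_M}` (and an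
  `ε`-form, and BR with a scale FUNCTION `K(n)`, `exists_scaleFun_sum_openConn_le`), from
  `τ^{Λ_M}(0,x) ↑ τ(0,x)` (`tendsto_real_openConnIn_box_tau`).  BR proper = `K(n)` bounded.
* §2 CONDITIONAL BR `boxRestriction_of_armBudget` (the `θ(p_c) = 0` branch): an arm budget
  `|Λ_n| π_{Kn}² ≤ A Σ_{Λ_n} τ^{Λ_{(K+1)n}}` gives BR with `(A + 1, K + 1)`, by the landed BK split
  `stub_bkSplit`; the budget is crux-strength (`BoxGluing` gives it), not known unconditionally.
* §3 UNCONDITIONAL BR WITH POLYNOMIAL LOSS `sum_openConn_le_sq_mul_sum_openConnIn`: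
  `Σ_{Λ_n} τ ≤ 162 n² Σ_{Λ_n} τ^{Λ_n}` (`n ≥ 1`): numerator `≤ |Λ_n| ≤ 27 n³`, denominator `≥ n/6` by the
  sharpness floor `Σ_{z∈∂Λ_r} τ^{Λ_r}(0,z) ≥ 1/6` (`sum_sphere_real_openConnIn_ge`) summed over shells.
  The factor `n²` is what BR must remove: the numerator bound cannot drop below `θ²|Λ_n|` unless
  `θ(p_c) = 0` is proved, and order `n` is also the only growth in print for the FULL sum
  (`Σ_{Λ_R} τ ≥ cR`, Duminil-Copin 2019 §3).
* §4 WHY BLOCKED — BR is route-terminal.  `theta_sq_le_of_boxRestriction`: BR with `(C, K)` gives jump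
  gluing `θ(p_c)² ≤ C |Λ_n|⁻¹ Σ_{Λ_n} τ^{Λ_{Kn}}` with the SAME `(C, K)` (`θ² ≤ |Λ_n|⁻¹ Σ_{Λ_n} τ`,
  `theta_sq_le_ballAverage`); `percolationContinuityZ3_of_boxRestriction`: BR → `FreeBoxShattering`
  (stmt-4644) → `PercolationContinuityZ3`, i.e. BR can replace the crux in the deciding theorem
  `PercHyperscalingGluing.closes`; `critBallAverageDecay_of_boxRestriction`: BR →
  `FreeSusceptibilityPowerSaving` (stmt-5786) → `CritBallAverageDecay` (stmt-0833, `a = 1/2`) — BR is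
  exactly the missing transfer of free-box estimates to full space; `not_boxRestriction_of_theta_pos`:
  in a shattered jump world (`θ(p_c) > 0` ∧ `FreeBoxShattering`, excluded by no theorem) BR is FALSE;
  `boxRestriction_of_linearScaleLRO`: averaged linear-scale in-box LRO at `p_c` (Cerf's `X_D`,
  stmt-0855, box-averaged) gives BR.  So in the jump branch BR ⟺ averaged `X_D` at `p_c` (open; Cerf
  2015 Thm 1.3 reaches scale `n¹⁶`), in the `θ(p_c) = 0` branch BR ⟸ arm budget ⟸ crux ⟸ X_B
  (stmt-0846, landed `boxGluing_of_critAnnulusNonCrossing`); any proof of BR proves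
  `FreeBoxShattering → θ(p_c) = 0` on `ℤ³`.
-/

noncomputable section

namespace Summit.CriticalPhenomena.PercolationContinuityZ3.Theorems

open MeasureTheory Filter Topology
open Literature.Probability.Percolation Literature.Probability.LatticeModels
open Literature.Barriers.CriticalPhenomena
open Summit.CriticalPhenomena.PercolationContinuityZ3.Theses

namespace BoxRestriction

/-! ## §1 Qualitative box restriction: every `n` has its own scale -/

/-- `Σ_{x∈Λ_n} P(0 ↔ x inside Λ_M) → Σ_{x∈Λ_n} P(0 ↔ x)` as `M → ∞` (finite sum of the monotone
limits `tendsto_real_openConnIn_box_tau`). [folklore] -/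
theorem tendsto_sum_real_openConnIn_box (n : ℕ) :
    Tendsto (fun M : ℕ => ∑ x ∈ box 3 n,
        (bondPercolation (zdGraph 3) (criticalProbI 3)).real (openConnIn ↑(box 3 M) 0 x)) atTop
      (𝓝 (∑ x ∈ box 3 n, (bondPercolation (zdGraph 3) (criticalProbI 3)).real (openConn 0 x))) := by
  have h := tendsto_finsetSum (box 3 n)
    fun x _ => tendsto_real_openConnIn_box_tau (d := 3) (criticalProbI 3) x
  simpa only [tau_def] using h

/-- `1 ≤ Σ_{x∈Λ_n} P(0 ↔ x inside Λ_M)`: the `x = 0` term is `P(0 ↔ 0 inside Λ_M) = 1`. [folklore] -/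
theorem one_le_sum_real_openConnIn_box (n M : ℕ) :
    1 ≤ ∑ x ∈ box 3 n,
      (bondPercolation (zdGraph 3) (criticalProbI 3)).real (openConnIn ↑(box 3 M) 0 x) := by
  have h1 : (bondPercolation (zdGraph 3) (criticalProbI 3)).real
      (openConnIn ↑(box 3 M) (0 : Site 3) 0) = 1 := by
    rw [Set.eq_univ_of_forall fun _ => openConnIn_refl (Finset.mem_coe.2 (zero_mem_box 3 M)),
      probReal_univ]
  rw [← h1]
  exact Finset.single_le_sum (f := fun x =>
      (bondPercolation (zdGraph 3) (criticalProbI 3)).real (openConnIn ↑(box 3 M) 0 x))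
    (fun _ _ => measureReal_nonneg) (zero_mem_box 3 n)

/-- **Qualitative BR, `ε`-form**: for every `n` and `ε > 0` there is a scale `M` with
`Σ_{x∈Λ_n} τ(0,x) ≤ Σ_{x∈Λ_n} τ^{Λ_M}(0,x) + ε`. [folklore] -/
theorem exists_scale_sum_openConn_le_add (n : ℕ) {ε : ℝ} (hε : 0 < ε) :
    ∃ M : ℕ, ∑ x ∈ box 3 n, (bondPercolation (zdGraph 3) (criticalProbI 3)).real (openConn 0 x) ≤
      ∑ x ∈ box 3 n, (bondPercolation (zdGraph 3) (criticalProbI 3)).real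
        (openConnIn ↑(box 3 M) 0 x) + ε := by
  have h := (tendsto_sum_real_openConnIn_box n).eventually (Ioi_mem_nhds (sub_lt_self _ hε))
  obtain ⟨M, hM⟩ := (eventually_atTop.1 h)
  exact ⟨M, by linarith [hM M le_rfl]⟩

/-- **Qualitative BR** (each `n` its own box): `∀ n, ∃ M, Σ_{x∈Λ_n} τ(0,x) ≤ 2 Σ_{x∈Λ_n} τ^{Λ_M}(0,x)`
(`ε = 1 ≤` the `x = 0` term).  The registered stub is the assertion that `M = Kn` works with `K`
bounded. [folklore] -/
theorem exists_scale_sum_openConn_le (n : ℕ) :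
    ∃ M : ℕ, ∑ x ∈ box 3 n, (bondPercolation (zdGraph 3) (criticalProbI 3)).real (openConn 0 x) ≤
      2 * ∑ x ∈ box 3 n, (bondPercolation (zdGraph 3) (criticalProbI 3)).real
        (openConnIn ↑(box 3 M) 0 x) := by
  obtain ⟨M, hM⟩ := exists_scale_sum_openConn_le_add n one_pos
  exact ⟨M, by linarith [one_le_sum_real_openConnIn_box n M]⟩

/-- **BR with a scale function**: there is `K : ℕ → ℕ`, `K ≥ 1`, with
`Σ_{x∈Λ_n} τ(0,x) ≤ 2 Σ_{x∈Λ_n} τ^{Λ_{K(n)·n}}(0,x)` for all `n ≥ 1`.  BR proper asks for `K` bounded.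
[folklore] -/
theorem exists_scaleFun_sum_openConn_le :
    ∃ K : ℕ → ℕ, (∀ n, 1 ≤ K n) ∧ ∀ n : ℕ, 1 ≤ n →
      ∑ x ∈ box 3 n, (bondPercolation (zdGraph 3) (criticalProbI 3)).real (openConn 0 x) ≤
        2 * ∑ x ∈ box 3 n, (bondPercolation (zdGraph 3) (criticalProbI 3)).real
          (openConnIn ↑(box 3 (K n * n)) 0 x) := by
  choose M hM using exists_scale_sum_openConn_le
  refine ⟨fun n => M n + 1, fun n => Nat.succ_pos _, fun n hn => (hM n).trans ?_⟩
  have hle : M n ≤ (M n + 1) * n := by nlinarith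
  exact mul_le_mul_of_nonneg_left (Finset.sum_le_sum fun x _ => measureReal_mono
    (openConnIn_box_mono (d := 3) x hle)) zero_le_two

/-! ## §2 Conditional BR from an arm budget (the `θ(p_c) = 0` branch), by the landed BK split -/

/-- **BR from an arm budget.**  If `|Λ_n| π_{Kn}² ≤ A Σ_{x∈Λ_n} τ^{Λ_{(K+1)n}}(0,x)` for all `n ≥ 1`
(`π_m = P_{p_c}(0 ↔ ∂Λ_m)`), then BR holds with constant `A + 1` and box `Λ_{(K+1)n}`: sum the BK
split `τ(0,x) ≤ τ^{Λ_{(K+1)n}}(0,x) + π_{Kn}²` (`stub_bkSplit`) over `x ∈ Λ_n`.  The budget is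
crux-strength (`BoxGluing` gives it with `A = C`, `π_{Kn} ≤ π_n`) and undecided by the bounds in
print (`π_n ≥ c/n`, `exists_oneArmProb_criticalProbI_three_lower`; `Σ_{Λ_n} τ^{Λ_n} ≥ n/6`, §3).
[folklore] -/
theorem boxRestriction_of_armBudget {A : ℝ} {K : ℕ} (hA : 0 ≤ A)
    (hπ : ∀ n : ℕ, 1 ≤ n →
      ((box 3 n).card : ℝ) *
          (bondPercolation (zdGraph 3) (criticalProbI 3)).real (siteToBoundary 3 (K * n)) ^ 2 ≤
        A * ∑ x ∈ box 3 n, (bondPercolation (zdGraph 3) (criticalProbI 3)).real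
          (openConnIn ↑(box 3 ((K + 1) * n)) 0 x)) :
    ∃ C : ℝ, ∃ K : ℕ, 0 < C ∧ 1 ≤ K ∧ ∀ n : ℕ, 1 ≤ n →
      ∑ x ∈ box 3 n, (bondPercolation (zdGraph 3) (criticalProbI 3)).real (openConn 0 x) ≤
        C * ∑ x ∈ box 3 n, (bondPercolation (zdGraph 3) (criticalProbI 3)).real
          (openConnIn ↑(box 3 (K * n)) 0 x) := by
  refine ⟨A + 1, K + 1, by positivity, Nat.le_add_left 1 K, fun n hn => ?_⟩
  set P : Measure (BondConfig (Site 3)) := bondPercolation (zdGraph 3) (criticalProbI 3) with hP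
  calc ∑ x ∈ box 3 n, P.real (openConn 0 x)
      ≤ ∑ x ∈ box 3 n, (P.real (openConnIn ↑(box 3 ((K + 1) * n)) 0 x) +
          P.real (siteToBoundary 3 (K * n)) ^ 2) :=
        Finset.sum_le_sum fun x hx => stub_bkSplit K n x hx
    _ = ∑ x ∈ box 3 n, P.real (openConnIn ↑(box 3 ((K + 1) * n)) 0 x) +
          ((box 3 n).card : ℝ) * P.real (siteToBoundary 3 (K * n)) ^ 2 := by
        rw [Finset.sum_add_distrib, Finset.sum_const, nsmul_eq_mul]
    _ ≤ ∑ x ∈ box 3 n, P.real (openConnIn ↑(box 3 ((K + 1) * n)) 0 x) +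
          A * ∑ x ∈ box 3 n, P.real (openConnIn ↑(box 3 ((K + 1) * n)) 0 x) :=
        add_le_add_right (hπ n hn) _
    _ = (A + 1) * ∑ x ∈ box 3 n, P.real (openConnIn ↑(box 3 ((K + 1) * n)) 0 x) := by ring

/-! ## §3 Unconditional BR with polynomial loss -/

/-- **Sharpness floor for the in-box ball sum at `p_c(ℤ³)`**: `Σ_{x∈Λ_n} P_{p_c}(0 ↔ x inside Λ_n) ≥ n/6`
(shells: `Σ_{z∈∂Λ_{k+1}} P_{p_c}(0 ↔ z inside Λ_{k+1}) ≥ 1/6`, Kozma–Nachmias 2011 Lemma 3.1 in the tree's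
form `sum_sphere_real_openConnIn_ge`, i.e. Duminil-Copin–Tassion's `φ_{p_c}(Λ_{k+1}) ≥ 1`; and
`Λ_k ⊆ Λ_{k+1}`). [folklore] -/
theorem sum_real_openConnIn_box_ge (n : ℕ) :
    (n : ℝ) / 6 ≤ ∑ x ∈ box 3 n, (bondPercolation (zdGraph 3) (criticalProbI 3)).real
      (openConnIn ↑(box 3 n) 0 x) := by
  set P : Measure (BondConfig (Site 3)) := bondPercolation (zdGraph 3) (criticalProbI 3) with hP
  have hp : criticalProb (zdGraph 3) (0 : Site 3) ≤ ((criticalProbI 3 : unitInterval) : ℝ) :=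
    le_of_eq (coe_criticalProbI 3).symm
  induction n with
  | zero =>
    simp only [Nat.cast_zero, zero_div]
    exact Finset.sum_nonneg fun _ _ => measureReal_nonneg
  | succ k ih =>
    have hsub : box 3 k ⊆ box 3 (k + 1) := box_mono 3 (Nat.le_succ k)
    rw [← Finset.sum_sdiff hsub]
    have hmono : ∑ x ∈ box 3 k, P.real (openConnIn ↑(box 3 k) 0 x) ≤
        ∑ x ∈ box 3 k, P.real (openConnIn ↑(box 3 (k + 1)) 0 x) :=
      Finset.sum_le_sum fun x _ => measureReal_mono (openConnIn_box_mono (d := 3) x (Nat.le_succ k))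
    have hshell : (1 : ℝ) / (2 * (3 : ℕ)) ≤
        ∑ x ∈ box 3 (k + 1) \ box 3 k, P.real (openConnIn ↑(box 3 (k + 1)) 0 x) := by
      rw [← sphere_succ_eq_sdiff]
      exact sum_sphere_real_openConnIn_ge (d := 3) (by norm_num) (criticalProbI 3) hp (k + 1)
    push_cast at hshell ⊢
    linarith

/-- `Σ_{x∈Λ_n} τ(0,x) ≤ |Λ_n| = (2n+1)³` (each term `≤ 1`). [folklore] -/
theorem sum_real_openConn_le_card (n : ℕ) :
    ∑ x ∈ box 3 n, (bondPercolation (zdGraph 3) (criticalProbI 3)).real (openConn 0 x) ≤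
      ((box 3 n).card : ℝ) := by
  calc ∑ x ∈ box 3 n, (bondPercolation (zdGraph 3) (criticalProbI 3)).real (openConn 0 x)
      ≤ ∑ _x ∈ box 3 n, (1 : ℝ) := Finset.sum_le_sum fun _ _ => measureReal_le_one
    _ = ((box 3 n).card : ℝ) := by rw [Finset.sum_const, nsmul_eq_mul, mul_one]

/-- **Unconditional BR with polynomial loss** (`K = 1`): for `n ≥ 1`,
`Σ_{x∈Λ_n} τ(0,x) ≤ 162 n² · Σ_{x∈Λ_n} τ^{Λ_n}(0,x)` — numerator `≤ |Λ_n| = (2n+1)³ ≤ 27 n³`,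
denominator `≥ n/6` (`sum_real_openConnIn_box_ge`).  The registered stub asks for `162 n² ↦ C`.
[folklore] -/
theorem sum_openConn_le_sq_mul_sum_openConnIn (n : ℕ) (hn : 1 ≤ n) :
    ∑ x ∈ box 3 n, (bondPercolation (zdGraph 3) (criticalProbI 3)).real (openConn 0 x) ≤
      162 * (n : ℝ) ^ 2 * ∑ x ∈ box 3 n, (bondPercolation (zdGraph 3) (criticalProbI 3)).real
        (openConnIn ↑(box 3 n) 0 x) := by
  have h1 := sum_real_openConn_le_card n
  have h2 := sum_real_openConnIn_box_ge n
  have hcard : ((box 3 n).card : ℝ) = (2 * (n : ℝ) + 1) ^ 3 := by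
    rw [card_box]; push_cast; ring
  have hn' : (1 : ℝ) ≤ n := by exact_mod_cast hn
  have h3 : (2 * (n : ℝ) + 1) ^ 3 ≤ 27 * (n : ℝ) ^ 3 := by
    have h : (2 * (n : ℝ) + 1) ≤ 3 * n := by linarith
    calc (2 * (n : ℝ) + 1) ^ 3 ≤ (3 * (n : ℝ)) ^ 3 := pow_le_pow_left₀ (by positivity) h 3
      _ = 27 * (n : ℝ) ^ 3 := by ring
  calc ∑ x ∈ box 3 n, (bondPercolation (zdGraph 3) (criticalProbI 3)).real (openConn 0 x)
      ≤ 27 * (n : ℝ) ^ 3 := h1.trans (hcard ▸ h3)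
    _ = 162 * (n : ℝ) ^ 2 * ((n : ℝ) / 6) := by ring
    _ ≤ _ := mul_le_mul_of_nonneg_left h2 (by positivity)

/-! ## §4 Why the stub is blocked: BR is route-terminal (jump branch) -/

/-- **BR ⟹ JumpGluing, same constants.**  From `Σ_{Λ_n} τ ≤ C Σ_{Λ_n} τ^{Λ_{Kn}}` at one `n`:
`θ(p_c)² ≤ C |Λ_n|⁻¹ Σ_{x∈Λ_n} τ^{Λ_{Kn}}(0,x)`, because `θ² ≤ |Λ_n|⁻¹ Σ_{Λ_n} τ`
(`theta_sq_le_ballAverage`: `τ(0,x) ≥ θ²`, FKG + uniqueness). [folklore] -/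
theorem theta_sq_le_of_boxRestriction {C : ℝ} {K n : ℕ}
    (h : ∑ x ∈ box 3 n, (bondPercolation (zdGraph 3) (criticalProbI 3)).real (openConn 0 x) ≤
      C * ∑ x ∈ box 3 n, (bondPercolation (zdGraph 3) (criticalProbI 3)).real
        (openConnIn ↑(box 3 (K * n)) 0 x)) :
    theta (zdGraph 3) 0 (criticalProbI 3) ^ 2 ≤
      C * ((box 3 n).card : ℝ)⁻¹ * ∑ x ∈ box 3 n,
        (bondPercolation (zdGraph 3) (criticalProbI 3)).real (openConnIn ↑(box 3 (K * n)) 0 x) := by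
  have hcard : (0 : ℝ) < ((box 3 n).card : ℝ) := by exact_mod_cast (box_nonempty 3 n).card_pos
  have h0 := theta_sq_le_ballAverage (d := 3) (criticalProbI 3) n
  simp only [tau_def] at h0
  calc theta (zdGraph 3) 0 (criticalProbI 3) ^ 2
      ≤ (∑ x ∈ box 3 n, (bondPercolation (zdGraph 3) (criticalProbI 3)).real (openConn 0 x)) /
          ((box 3 n).card : ℝ) := h0
    _ ≤ (C * ∑ x ∈ box 3 n, (bondPercolation (zdGraph 3) (criticalProbI 3)).real
          (openConnIn ↑(box 3 (K * n)) 0 x)) / ((box 3 n).card : ℝ) :=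
        div_le_div_of_nonneg_right h hcard.le
    _ = _ := by rw [div_eq_mul_inv]; ring

/-- **BR ⟹ JumpGluing** (`∃ C > 0, K ≥ 1, ∀ n ≥ 1, θ(p_c)² ≤ C |Λ_n|⁻¹ Σ_{Λ_n} τ^{Λ_{Kn}}`), which is
all that the route's deciding theorem `PercHyperscalingGluing.closes` consumes of the crux `BoxGluing`
(it uses `BoxGluing` only through `θ ≤ π_n`). [folklore] -/
theorem jumpGluing_of_boxRestriction
    (hBR : ∃ C : ℝ, ∃ K : ℕ, 0 < C ∧ 1 ≤ K ∧ ∀ n : ℕ, 1 ≤ n →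
      ∑ x ∈ box 3 n, (bondPercolation (zdGraph 3) (criticalProbI 3)).real (openConn 0 x) ≤
        C * ∑ x ∈ box 3 n, (bondPercolation (zdGraph 3) (criticalProbI 3)).real
          (openConnIn ↑(box 3 (K * n)) 0 x)) :
    ∃ C : ℝ, ∃ K : ℕ, 0 < C ∧ 1 ≤ K ∧ ∀ n : ℕ, 1 ≤ n →
      theta (zdGraph 3) 0 (criticalProbI 3) ^ 2 ≤
        C * ((box 3 n).card : ℝ)⁻¹ * ∑ x ∈ box 3 n,
          (bondPercolation (zdGraph 3) (criticalProbI 3)).real (openConnIn ↑(box 3 (K * n)) 0 x) := by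
  obtain ⟨C, K, hC, hK, h⟩ := hBR
  exact ⟨C, K, hC, hK, fun n hn => theta_sq_le_of_boxRestriction (h n hn)⟩

/-- **BR puts the full-space ball sum under the free-box sum at scale `Kn`**: BR with `(C, K)` gives
`Σ_{x∈Λ_n} τ(0,x) ≤ C Σ_{x∈Λ_{Kn}} τ^{Λ_{Kn}}(0,x) = C |Λ_{Kn}| F_{Kn}` for `n ≥ 1` (`Λ_n ⊆ Λ_{Kn}`, terms
`≥ 0`) — the passage "box-restricted ⟹ full-space" that Hutchcroft 2022 p.5 records as unknown for the
nearest-neighbour model. [folklore] -/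
theorem sum_openConn_le_freeBoxSum_of_boxRestriction {C : ℝ} {K n : ℕ} (hC : 0 ≤ C) (hK : 1 ≤ K)
    (h : ∑ x ∈ box 3 n, (bondPercolation (zdGraph 3) (criticalProbI 3)).real (openConn 0 x) ≤
      C * ∑ x ∈ box 3 n, (bondPercolation (zdGraph 3) (criticalProbI 3)).real
        (openConnIn ↑(box 3 (K * n)) 0 x)) :
    ∑ x ∈ box 3 n, (bondPercolation (zdGraph 3) (criticalProbI 3)).real (openConn 0 x) ≤
      C * ∑ x ∈ box 3 (K * n), (bondPercolation (zdGraph 3) (criticalProbI 3)).real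
        (openConnIn ↑(box 3 (K * n)) 0 x) :=
  h.trans (mul_le_mul_of_nonneg_left (Finset.sum_le_sum_of_subset_of_nonneg
    (box_mono 3 (Nat.le_mul_of_pos_left n hK)) fun _ _ _ => measureReal_nonneg) hC)

/-- **BR is route-terminal**: BR and free-box shattering `F_r = |Λ_r|⁻¹ Σ_{Λ_r} τ^{Λ_r} → 0`
(crux `FreeBoxShattering`, stmt-CriticalPhenomena-4644) give `θ(p_c) = 0` on `ℤ³` — BR can stand in
for `BoxGluing` in the route's deciding theorem `PercHyperscalingGluing.closes` (same bookkeeping, with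
`θ² ≤ |Λ_n|⁻¹ Σ_{Λ_n} τ` in place of `θ ≤ π_n`): for `n ≥ 1`,
`θ² ≤ C |Λ_n|⁻¹ Σ_{Λ_{Kn}} τ^{Λ_{Kn}} = C (|Λ_{Kn}|/|Λ_n|) F_{Kn} ≤ C K³ F_{Kn} → 0`.  Consequently any
proof of the stub proves `FreeBoxShattering → PercolationContinuityZ3`. [folklore] -/
theorem percolationContinuityZ3_of_boxRestriction
    (hBR : ∃ C : ℝ, ∃ K : ℕ, 0 < C ∧ 1 ≤ K ∧ ∀ n : ℕ, 1 ≤ n →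
      ∑ x ∈ box 3 n, (bondPercolation (zdGraph 3) (criticalProbI 3)).real (openConn 0 x) ≤
        C * ∑ x ∈ box 3 n, (bondPercolation (zdGraph 3) (criticalProbI 3)).real
          (openConnIn ↑(box 3 (K * n)) 0 x))
    (hF : PercHyperscalingGluing.FreeBoxShattering) : _root_.PercolationContinuityZ3 := by
  obtain ⟨C, K, hC, hK, h⟩ := hBR
  show theta (zdGraph 3) 0 (criticalProbI 3) = 0
  set P : Measure (BondConfig (Site 3)) := bondPercolation (zdGraph 3) (criticalProbI 3) with hP
  set θ : ℝ := theta (zdGraph 3) 0 (criticalProbI 3) with hθ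
  set F : ℕ → ℝ := fun r : ℕ => ((box 3 r).card : ℝ)⁻¹ *
      ∑ x ∈ box 3 r, P.real (openConnIn ↑(box 3 r) 0 x) with hFdef
  have hF' : Tendsto F atTop (𝓝 0) := hF
  have hcard : ∀ L : ℕ, ((box 3 L).card : ℝ) = (2 * (L : ℝ) + 1) ^ 3 := by
    intro L
    rw [card_box]; push_cast; ring
  have hcard_pos : ∀ L : ℕ, (0 : ℝ) < ((box 3 L).card : ℝ) := by
    intro L; rw [hcard]; positivity
  -- θ² ≤ C K³ F(Kn) for n ≥ 1
  have key : ∀ n : ℕ, 1 ≤ n → θ ^ 2 ≤ C * (K : ℝ) ^ 3 * F (K * n) := by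
    intro n hn
    have ha := hcard_pos n
    -- BR at scale n, full-space sum under the free-box sum at scale Kn, divided by |Λ_n|
    have h1 : θ ^ 2 ≤ ((box 3 n).card : ℝ)⁻¹ *
        (C * ∑ x ∈ box 3 (K * n), P.real (openConnIn ↑(box 3 (K * n)) 0 x)) := by
      have h0 := theta_sq_le_ballAverage (d := 3) (criticalProbI 3) n
      simp only [tau_def] at h0
      rw [div_eq_inv_mul] at h0
      exact h0.trans (mul_le_mul_of_nonneg_left
        (sum_openConn_le_freeBoxSum_of_boxRestriction hC.le hK (h n hn)) (inv_nonneg.2 ha.le))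
    have h4 : ∑ x ∈ box 3 (K * n), P.real (openConnIn ↑(box 3 (K * n)) 0 x) =
        ((box 3 (K * n)).card : ℝ) * F (K * n) := by
      simp only [hFdef]
      rw [← mul_assoc, mul_inv_cancel₀ (hcard_pos (K * n)).ne', one_mul]
    have hFn : 0 ≤ F (K * n) :=
      mul_nonneg (inv_nonneg.2 (hcard_pos _).le) (Finset.sum_nonneg fun _ _ => measureReal_nonneg)
    have hratio : ((box 3 (K * n)).card : ℝ) ≤ (K : ℝ) ^ 3 * ((box 3 n).card : ℝ) := by
      rw [hcard, hcard, ← mul_pow]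
      push_cast
      have hK1 : (1 : ℝ) ≤ K := by exact_mod_cast hK
      have hn0 : (0 : ℝ) ≤ n := Nat.cast_nonneg n
      apply pow_le_pow_left₀ (by positivity)
      nlinarith
    calc θ ^ 2 ≤ ((box 3 n).card : ℝ)⁻¹ * (C * (((box 3 (K * n)).card : ℝ) * F (K * n))) := by
          rw [← h4]; exact h1
      _ ≤ ((box 3 n).card : ℝ)⁻¹ * (C * (((K : ℝ) ^ 3 * ((box 3 n).card : ℝ)) * F (K * n))) :=
          mul_le_mul_of_nonneg_left (mul_le_mul_of_nonneg_left
            (mul_le_mul_of_nonneg_right hratio hFn) hC.le) (inv_nonneg.2 ha.le)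
      _ = C * (K : ℝ) ^ 3 * F (K * n) * (((box 3 n).card : ℝ)⁻¹ * ((box 3 n).card : ℝ)) := by ring
      _ = C * (K : ℝ) ^ 3 * F (K * n) := by rw [inv_mul_cancel₀ ha.ne', mul_one]
  have hKn : Tendsto (fun n : ℕ => K * n) atTop atTop :=
    tendsto_atTop_mono (fun n => Nat.le_mul_of_pos_left n hK) tendsto_id
  have hlim : Tendsto (fun n : ℕ => C * (K : ℝ) ^ 3 * F (K * n)) atTop (𝓝 0) := by
    have := (hF'.comp hKn).const_mul (C * (K : ℝ) ^ 3)
    simpa using this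
  have hsq : θ ^ 2 ≤ 0 := ge_of_tendsto hlim (eventually_atTop.2 ⟨1, key⟩)
  exact pow_eq_zero_iff two_ne_zero |>.1 (le_antisymm hsq (sq_nonneg θ))

/-- **BR transfers rates (cross-route edge to `PercTwoPointDecay`)**: BR and the free-susceptibility
power saving `Σ_{y∈Λ_R} τ^{Λ_R}(0,y) ≤ C' R^{5/2}` (crux `FreeSusceptibilityPowerSaving`,
stmt-CriticalPhenomena-5786) give the full-space ball-sum saving `CritBallAverageDecay` (X_A, stmt-0833)
with `a = 1/2`: `Σ_{Λ_R} τ ≤ C Σ_{Λ_{KR}} τ^{Λ_{KR}} ≤ C C' (KR)^{5/2}`. [folklore] -/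
theorem critBallAverageDecay_of_boxRestriction
    (hBR : ∃ C : ℝ, ∃ K : ℕ, 0 < C ∧ 1 ≤ K ∧ ∀ n : ℕ, 1 ≤ n →
      ∑ x ∈ box 3 n, (bondPercolation (zdGraph 3) (criticalProbI 3)).real (openConn 0 x) ≤
        C * ∑ x ∈ box 3 n, (bondPercolation (zdGraph 3) (criticalProbI 3)).real
          (openConnIn ↑(box 3 (K * n)) 0 x))
    (hS : PercTwoPointDecay.FreeSusceptibilityPowerSaving) : PercTwoPointDecay.CritBallAverageDecay := by
  obtain ⟨C, K, hC, hK, h⟩ := hBR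
  obtain ⟨C', hS⟩ := hS
  refine ⟨1 / 2, C * C' * (K : ℝ) ^ ((5 : ℝ) / 2), one_half_pos, fun R hR => ?_⟩
  have hKR : 1 ≤ K * R := Nat.le_mul_of_pos_left R hK |>.trans' hR
  have h3 := hS (K * R) hKR
  have h4 : (((K * R : ℕ)) : ℝ) ^ ((5 : ℝ) / 2) = (K : ℝ) ^ ((5 : ℝ) / 2) * (R : ℝ) ^ ((5 : ℝ) / 2) := by
    push_cast
    exact Real.mul_rpow (Nat.cast_nonneg K) (Nat.cast_nonneg R)
  have h5 : (3 : ℝ) - 1 / 2 = (5 : ℝ) / 2 := by norm_num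
  rw [h5]
  calc ∑ x ∈ box 3 R, (bondPercolation (zdGraph 3) (criticalProbI 3)).real (openConn 0 x)
      ≤ C * ∑ x ∈ box 3 (K * R), (bondPercolation (zdGraph 3) (criticalProbI 3)).real
          (openConnIn ↑(box 3 (K * R)) 0 x) :=
        sum_openConn_le_freeBoxSum_of_boxRestriction hC.le hK (h R hR)
    _ ≤ C * (C' * (((K * R : ℕ)) : ℝ) ^ ((5 : ℝ) / 2)) := mul_le_mul_of_nonneg_left h3 hC.le
    _ = C * C' * (K : ℝ) ^ ((5 : ℝ) / 2) * (R : ℝ) ^ ((5 : ℝ) / 2) := by rw [h4]; ring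

/-- **BR is FALSE in a shattered jump world**: if `θ(p_c) > 0` on `ℤ³` and the free box shatters
(`FreeBoxShattering`), the registered stub fails — a world excluded by no theorem in print. [folklore] -/
theorem not_boxRestriction_of_theta_pos
    (hθ : 0 < theta (zdGraph 3) 0 (criticalProbI 3))
    (hF : PercHyperscalingGluing.FreeBoxShattering) :
    ¬ ∃ C : ℝ, ∃ K : ℕ, 0 < C ∧ 1 ≤ K ∧ ∀ n : ℕ, 1 ≤ n →
      ∑ x ∈ box 3 n, (bondPercolation (zdGraph 3) (criticalProbI 3)).real (openConn 0 x) ≤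
        C * ∑ x ∈ box 3 n, (bondPercolation (zdGraph 3) (criticalProbI 3)).real
          (openConnIn ↑(box 3 (K * n)) 0 x) :=
  fun hBR => hθ.ne' (percolationContinuityZ3_of_boxRestriction hBR hF)

/-- **Jump-branch converse: averaged linear-scale in-box LRO ⟹ BR.**  If
`c |Λ_n| ≤ Σ_{x∈Λ_n} τ^{Λ_{Kn}}(0,x)` for all `n ≥ 1` (`c > 0`, `K ≥ 1`; the box average of Cerf's
`X_D` at `p_c`, stmt-CriticalPhenomena-0855), then BR holds with `C = 1/c` (`Σ_{Λ_n} τ ≤ |Λ_n|`).  With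
`theta_sq_le_of_boxRestriction`: when `θ(p_c) > 0`, BR ⟺ averaged linear-scale in-box LRO at `p_c`.
[folklore] -/
theorem boxRestriction_of_linearScaleLRO
    (h : ∃ c : ℝ, ∃ K : ℕ, 0 < c ∧ 1 ≤ K ∧ ∀ n : ℕ, 1 ≤ n →
      c * ((box 3 n).card : ℝ) ≤ ∑ x ∈ box 3 n,
        (bondPercolation (zdGraph 3) (criticalProbI 3)).real (openConnIn ↑(box 3 (K * n)) 0 x)) :
    ∃ C : ℝ, ∃ K : ℕ, 0 < C ∧ 1 ≤ K ∧ ∀ n : ℕ, 1 ≤ n →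
      ∑ x ∈ box 3 n, (bondPercolation (zdGraph 3) (criticalProbI 3)).real (openConn 0 x) ≤
        C * ∑ x ∈ box 3 n, (bondPercolation (zdGraph 3) (criticalProbI 3)).real
          (openConnIn ↑(box 3 (K * n)) 0 x) := by
  obtain ⟨c, K, hc, hK, h⟩ := h
  refine ⟨1 / c, K, by positivity, hK, fun n hn => ?_⟩
  calc ∑ x ∈ box 3 n, (bondPercolation (zdGraph 3) (criticalProbI 3)).real (openConn 0 x)
      ≤ ((box 3 n).card : ℝ) := sum_real_openConn_le_card n
    _ = 1 / c * (c * ((box 3 n).card : ℝ)) := by field_simp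
    _ ≤ _ := mul_le_mul_of_nonneg_left (h n hn) (by positivity)

end BoxRestriction

end Summit.CriticalPhenomena.PercolationContinuityZ3.Theorems

end
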